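import Summits.MatrixMultiplication.MatrixMultiplication.Theorems.SoloInformedExceptionCalculus

/-!
# Two constant rows of `a`, two constant rows of `c` (every chart)

This work, §8.8 (T12) (gen 107), THEOREMS 8.16a and 8.16c — the remaining two-line theorems. With `Adm.rotate`
(`Adm x v w → Adm v w x`) every equation `E(i,j,k)` can be read with any of its three entries as the "outer" one,
so the general two-centre lemma `signEq_of_mem_inter₃` gives:
* `Data.card_mul_le_of_two_arows`: two rows `i₀`, `i₀'` of `a` class-constant (`α`, `α'`) on a common column set
  `J*` force, for every `k` outside `{k : (α ~ α' ∧ c k i₀ ~ c k i₀') ∨ (α ~ c k i₀' ∧ α' ~ c k i₀)}`, the column `k`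
  of `b` to be class-constant on `J*`; the first laziness bound `Data.card_mul_le_of_b_rowsOn₂` then pays
  `n · |K₁| · |J*| ≤ r · |S⁰|`.
* `Data.sq_mul_min_le_of_two_crows`: two rows `k₀`, `k₀'` of `c` class-constant (`u`, `u'`) on a common `I*` force,
  for every `j` outside `{j : (u ~ u' ∧ b j k₀ ~ b j k₀') ∨ (u ~ b j k₀' ∧ u' ~ b j k₀)}`, the column `j` of `a` to
  be class-constant on `I*`; THEOREM 8.15 `Data.sq_mul_min_le_of_rect` then pays
  `n² · min(|I*|, |J'|/2) ≤ 2 · r · |S⁰|`.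
References: this work §8.8; CohnUmans2013 Def. 12.
-/

namespace Summit.MatrixMultiplication.MatrixMultiplication.Theorems.TwistedTPP

namespace FibreLines

variable {ι G : Type*} [AddCommGroup G]

/-- `Adm` is invariant under cyclic rotation of its three slots. -/
theorem Adm.rotate {x v w : G} (h : Adm x v w) : Adm v w x := by
  rcases h with h | h | h | h
  · exact Or.inl (by rw [← h]; abel)
  · exact Or.inr (Or.inr (Or.inl (by rw [← h]; abel)))
  · refine Or.inr (Or.inr (Or.inr ?_))
    rw [← neg_eq_zero, ← h]; abel
  · exact Or.inr (Or.inl (by rw [← neg_eq_zero, ← h]; abel))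

variable {G₀ R : Type*} [AddCommGroup G₀]

/-- **THEOREM 8.16a (two constant rows of `a`, every chart).** [this work, §8.8 (T12)] -/
theorem Data.card_mul_le_of_two_arows [Fintype ι] [DecidableEq ι] [Fintype G₀] [DecidableEq G₀]
    [Fintype R] [DecidableEq R] (hG : ∀ x : G, x = -x → x = 0) (D : Data ι G) (Φ : Chart ι G₀) (κ : G → R)
    (hκ : ∀ x y, κ x = κ y → SignEq x y) (hsep : D.SepAll Φ) {i₀ i₀' : ι} {α α' : G}
    (Js K₁ : Finset ι) (hi : ∀ j ∈ Js, SignEq (D.a i₀ j) α) (hi' : ∀ j ∈ Js, SignEq (D.a i₀' j) α')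
    (hK₁ : ∀ k ∈ K₁, ¬ (SignEq α α' ∧ SignEq (D.c k i₀) (D.c k i₀')))
    (hK : ∀ k ∈ K₁, ¬ (SignEq α (D.c k i₀') ∧ SignEq α' (D.c k i₀))) :
    Fintype.card ι * K₁.card * Js.card ≤ Fintype.card R * Fintype.card G₀ := by
  refine D.card_mul_le_of_b_rowsOn₂ Φ κ hκ hsep Js K₁ ?_
  intro j hj j' hj' k hk
  have e1 : ∀ j ∈ Js, SignEq (D.b j k) (D.c k i₀ + α) ∨ SignEq (D.b j k) (D.c k i₀ - α) := fun j hj =>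
    ((D.adm_eqn i₀ j k).of_signEq_left (hi j hj)).rotate.rotate.signEq_add_or_sub
  have e2 : ∀ j ∈ Js, SignEq (D.b j k) (D.c k i₀' + α') ∨ SignEq (D.b j k) (D.c k i₀' - α') := fun j hj =>
    ((D.adm_eqn i₀' j k).of_signEq_left (hi' j hj)).rotate.rotate.signEq_add_or_sub
  exact signEq_of_mem_inter₃ hG (hK₁ k hk) (hK k hk) (e1 j' hj') (e2 j' hj') (e1 j hj) (e2 j hj)

/-- **THEOREM 8.16c (two constant rows of `c`, every chart).** [this work, §8.8 (T12)] -/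
theorem Data.sq_mul_min_le_of_two_crows [Fintype ι] [DecidableEq ι] [Fintype G₀] [DecidableEq G₀]
    [Fintype R] [DecidableEq R] (hG : ∀ x : G, x = -x → x = 0) (D : Data ι G) (Φ : Chart ι G₀) (κ : G → R)
    (hκ : ∀ x y, κ x = κ y → SignEq x y) (hsep : D.SepAll Φ) {k₀ k₀' : ι} {u u' : G}
    (Is J' : Finset ι) (hk : ∀ i ∈ Is, SignEq (D.c k₀ i) u) (hk' : ∀ i ∈ Is, SignEq (D.c k₀' i) u')
    (hJ₁ : ∀ j ∈ J', ¬ (SignEq u u' ∧ SignEq (D.b j k₀) (D.b j k₀')))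
    (hJ : ∀ j ∈ J', ¬ (SignEq u (D.b j k₀') ∧ SignEq u' (D.b j k₀))) :
    Fintype.card ι ^ 2 * min Is.card (J'.card / 2) ≤ 2 * (Fintype.card R * Fintype.card G₀) := by
  rcases Is.eq_empty_or_nonempty with hI | ⟨i₁, hi₁⟩
  · simp [hI]
  refine D.sq_mul_min_le_of_rect hG Φ κ hκ hsep Is J' (fun j => D.a i₁ j) ?_
  intro j hj i hi
  have e1 : ∀ i ∈ Is, SignEq (D.a i j) (D.b j k₀ + u) ∨ SignEq (D.a i j) (D.b j k₀ - u) := fun i hi =>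
    ((D.adm_eqn i j k₀).of_signEq_right (hk i hi)).rotate.signEq_add_or_sub
  have e2 : ∀ i ∈ Is, SignEq (D.a i j) (D.b j k₀' + u') ∨ SignEq (D.a i j) (D.b j k₀' - u') := fun i hi =>
    ((D.adm_eqn i j k₀').of_signEq_right (hk' i hi)).rotate.signEq_add_or_sub
  exact signEq_of_mem_inter₃ hG (hJ₁ j hj) (hJ j hj) (e1 i hi) (e2 i hi) (e1 i₁ hi₁) (e2 i₁ hi₁)

end FibreLines

end Summit.MatrixMultiplication.MatrixMultiplication.Theorems.TwistedTPP
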